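import Summits.ABC.ABC.Theorems.TwistAmplificationMazurKaneLawRecordFineDictionary
import Summits.ABC.ABC.Theorems.TwistAmplificationMazurKaneLawRecordFineEndgame
import Summits.ABC.ABC.Theorems.TwistAmplificationMazurKaneLawRecordLPRF
import Summits.ABC.ABC.Theorems.TwistAmplificationMazurKaneLawRecordLPR7
import Summits.ABC.ABC.Theorems.TwistAmplificationMazurKaneLawRecordLPRB
import Summits.ABC.ABC.Theorems.TwistAmplificationMazurKaneLawRecordLPRC
import Summits.ABC.ABC.Theorems.TwistAmplificationMazurKaneLawRecordLPRK
import Summits.ABC.ABC.Theorems.TwistAmplificationMazurKaneLawRecordLPRW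
import Summits.ABC.ABC.Theorems.TwistAmplificationMazurKaneLawRecordTransfer
import Summits.ABC.ABC.Theorems.TwistAmplificationMazurKaneLawRecords
import Summits.ABC.ABC.Theorems.TwistAmplificationMazurKaneLawRecordsV3
import Literature.NumberTheory.DiophantineGeometry.AbcWave0

/-!
# Certified record exponents, pipeline v2 — the FINE records (crux `TwistAmplification.MazurKaneLaw`, stmt-ABC-2757)

Line `fibre-toolkit-lp-wall-map`, lead c2. With the slack-coefficient variant `RecordInstanceK` (`…RecordFineDefs.lean`), its dictionary
theorem `recordInstanceK_of_lp` and endgame `shapeCount_le_of_recordInstanceK`, an LP certificate `telescope → D ≤ Vc + 3σ` certifies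
`RecordAt s₀ Vc` for every `Vc` strictly above the exact (`σ = 0`) value of the kit's linear programme. Two consequences:

* `abcHitCount_le_rpow_seven_twelfths` — **abc hits `N(X) ≪_ε X^{7/12 + ε}`** (`7/12 = 0.58333…`), from `recordAt_R7 :
  RecordAt (10001/10000) (7/12)` (generated LP lemma `lp_R7`, `J = 7` explicit levels, 1593-node cover tree in nine files). The exact LP
  value of the enlarged fibre toolkit at `s = 1` is `67/115 = 0.582608…` (`J = 7`; `0.5850` at `J = 6`, `0.5861` at `J = 5`), so `7/12` is this
  toolkit's natural constant. Literature: `13/20` at `λ = 1` and `3/5` for `λ < 1` (Bernert–Browning–Lichtman–Teräväinen v2, Thms 1.2–1.3);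
  this tree before this file: `3/5` (`abcHitCount_le_rpow_three_fifths`).
* `recordAt_RF` : for every `s₀ ∈ [7/4, 16/9]`, `RecordAt s₀ (4 s₀/5 − 19/45)` — the exponent is `< 1` for EVERY `s₀ < 16/9` and `= 1` at
  `s₀ = 16/9`; with `recordAt_74` (lead c1) this gives `mazurKane_subKane`: for every `s < 16/9` there are `θ < 1` and `C` with
  `#{abc triples, c ≤ N, rad(abc) ≤ c^s} ≤ C N^θ` — a power saving below Kane's `N^{1+ε}` on all of `(1, 16/9)`. From `16/9` on the kit's
  exact LP value is `1` (maximiser: two terms `u x² w³` with exponents `(2/9, 2/9, 1/9)`, one term `u x²` with `(1/3, 1/3)`), so `16/9` is the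
  END of what the enlarged fibre toolkit certifies below Kane; the residue `[16/9, 2)` is the conic-family / critical-Kloosterman problem
  recorded in the line card.
* `recordAt_RK` / **`mazurKaneLaw_on_Kane_range`** : for every `s₀ ∈ [2, 3]`, `RecordAt s₀ (s₀ − 1)`; literally: for `2 ≤ s < 3` and `ε > 0`,
  `#{abc triples, c ≤ N, rad(abc) ≤ c^s} ≤ C · N^{s − 1 + ε}` — the Mazur–Kane law itself HOLDS on Kane's range `[2, 3)` (the crux asks it on
  `(1, 2)`). Its certificate `lp_RK` has 5 nodes and uses only Kane's lattices and the sharp conic bound — the structure of Kane,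
  JNT 154 (2015) = arXiv:1104.2635, Thm 2, here in the joint-radical form and kernel-checked.
* `recordAt_RW` : for every `s₀ ∈ [16/9, 2]`, `RecordAt s₀ 1` — Kane's parasitic `N^{1+ε}` on the plateau, where the kit's exact value IS `1`
  (5-node certificate `lp_RW`; that the value is exactly `1` there for every `J` is the barrier theorem `kit_lp_value_one_at_sixteen_ninths`,
  file `…KitPlateau.lean`). The certified picture is now complete: the law on `[2,3)`, `1+ε` on `[16/9,2)`, `< 1` on `(1,16/9)`.
* `recordAt_RB`, `recordAt_RC` : two more parametric pieces of the certified curve, `(19 s₀ + 7)/40` on `[3/2, 8/5]` and `s₀/2 + 27/200` on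
  `[8/5, 33/20]` (standard slack; below `recordAt_RA`'s `(23 s₀+1)/40` there; kit values `.866 / .890 / .929 / .957` at `1.5 / 1.55 / 1.6 / 1.65`).
-/

noncomputable section

-- `Summit.<Summit>.<Problem>`: the duplicate `ABC.ABC` is deliberate (single-conjunct summit).
set_option linter.dupNamespace false

namespace Summit.ABC.ABC.Theorems.MazurKaneLaw

open Summit.ABC.ABC.Theorems.MazurKaneLaw.Toolkit

/-! ### `R7`: abc hits `≪ X^{7/12+ε}` -/

/-- **Record instance `R7`** (registered sub-goal `recordInstance_R7`): `RecordInstanceK 3 7 (10001/10000) (7/12)`, from the generated LP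
lemma `lp_R7` (`J = 7`, slack coefficient `3`) through `recordInstanceK_of_lp`. -/
theorem recordInstance_R7 : Summit.ABC.ABC.Theorems.MazurKaneLaw.Toolkit.RecordInstanceK 3 7 (10001 / 10000) (7 / 12) :=
  recordInstanceK_of_lp 3 7 (10001 / 10000) (7 / 12) (by norm_num) lp_R7

/-- **Certified record at `s₀ = 10001/10000` with exponent `7/12`** (registered sub-goal `recordAt_R7` of crux stmt-ABC-2757): for
every `s < 10001/10000` (in particular every `s ≤ 1`) and `ε > 0` there is `C` with
`#{abc triples (a,b,c) : c ≤ N, rad(abc) ≤ c^s} ≤ C · N^{7/12 + ε}` for all `N ≥ 2`. -/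
theorem recordAt_R7 : Summit.ABC.ABC.Theorems.MazurKaneLaw.Toolkit.RecordAt (10001 / 10000) (7 / 12) :=
  recordAt_of_shapeBound 7 (10001 / 10000) (7 / 12) (by norm_num) (by norm_num) (by norm_num) (by norm_num)
    (shapeCount_le_of_recordInstanceK 3 7 (10001 / 10000) (7 / 12) (by norm_num) (by norm_num) (by norm_num) recordInstance_R7)

/-- The `7/12` record in the crux's literal shape at every `s ≤ 1`. -/
theorem mazurKane_count_le_rpow_seven_twelfths (s : ℝ) (hs : s ≤ 1) (ε : ℝ) (hε : 0 < ε) :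
    ∃ C : ℝ, ∀ N : ℕ, 2 ≤ N →
      (Set.ncard {t : ℕ × ℕ × ℕ | Literature.NumberTheory.DiophantineGeometry.IsABCTriple t.1 t.2.1 t.2.2 ∧ t.2.2 ≤ N ∧
        ((Literature.NumberTheory.DiophantineGeometry.rad t.1 t.2.1 t.2.2 : ℕ) : ℝ) ≤ (t.2.2 : ℝ) ^ s} : ℝ) ≤
        C * (N : ℝ) ^ ((7 / 12 : ℝ) + ε) :=
  recordAt_R7 s (by linarith) ε hε

/-- **The abc-hit record: `N(X) ≪_ε X^{7/12 + ε}`** (registered sub-goal `abcHitCount_le_rpow_seven_twelfths`). The number of abc hits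
`(a, b, c)` (`a + b = c` coprime, `rad(abc) < c`) with `c ≤ X` is at most `C(ε) · X^{7/12 + ε}` for `X ≥ 2` (`7/12 = 0.58333…`; compare
`3/5` and `31/50` in this tree, `13/20` in the 2026 literature at `λ = 1`, `2/3` trivial). Pattern: `abcHitCount_le_rpow_three_fifths`. -/
theorem abcHitCount_le_rpow_seven_twelfths : ∀ ε : ℝ, 0 < ε → ∃ C : ℝ, ∀ X : ℕ, 2 ≤ X → (Literature.NumberTheory.DiophantineGeometry.abcHitCount X : ℝ) ≤ C * (X : ℝ) ^ ((7 / 12 : ℝ) + ε) := by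
  intro ε hε
  -- adapted from `abcHitCount_le_rpow_thirtyOne_fiftieths` (TwistAmplificationMazurKaneLawRecords.lean)
  obtain ⟨C, hC⟩ := recordAt_R7 1 (by norm_num) ε hε
  refine ⟨C, fun X hX => le_trans ?_ (hC X hX)⟩
  have hsub : {t : ℕ × ℕ × ℕ | Literature.NumberTheory.DiophantineGeometry.IsABCTriple t.1 t.2.1 t.2.2 ∧ t.2.2 ≤ X ∧
        Literature.NumberTheory.DiophantineGeometry.rad t.1 t.2.1 t.2.2 < t.2.2} ⊆
      {t : ℕ × ℕ × ℕ | Literature.NumberTheory.DiophantineGeometry.IsABCTriple t.1 t.2.1 t.2.2 ∧ t.2.2 ≤ X ∧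
        ((Literature.NumberTheory.DiophantineGeometry.rad t.1 t.2.1 t.2.2 : ℕ) : ℝ) ≤ (t.2.2 : ℝ) ^ (1 : ℝ)} := by
    rintro t ⟨ht, htX, hlt⟩
    refine ⟨ht, htX, ?_⟩
    rw [Real.rpow_one]
    exact_mod_cast hlt.le
  have hfin : {t : ℕ × ℕ × ℕ | Literature.NumberTheory.DiophantineGeometry.IsABCTriple t.1 t.2.1 t.2.2 ∧ t.2.2 ≤ X ∧
      ((Literature.NumberTheory.DiophantineGeometry.rad t.1 t.2.1 t.2.2 : ℕ) : ℝ) ≤ (t.2.2 : ℝ) ^ (1 : ℝ)}.Finite :=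
    Summit.ABC.ABC.Theorems.MazurKaneLaw.finite_of_isABCTriple X fun _ ht => ⟨ht.1, ht.2.1⟩
  rw [Literature.NumberTheory.DiophantineGeometry.abcHitCount]
  exact_mod_cast Set.ncard_le_ncard hsub hfin

/-! ### `RF`: `s₀ ∈ [7/4, 16/9]`, exponent `4 s₀/5 − 19/45` — below `1` for every `s₀ < 16/9` -/

/-- **Parametric fine record instance `RF`** (registered sub-goal `recordInstance_RF`): for every `s₀ ∈ [7/4, 16/9]`,
`RecordInstanceK 3 5 s₀ ((4/5) s₀ − 19/45)`, from the generated parametric LP lemma `lp_RF`. -/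
theorem recordInstance_RF : ∀ s₀ : ℝ, 7 / 4 ≤ s₀ → s₀ ≤ 16 / 9 → Summit.ABC.ABC.Theorems.MazurKaneLaw.Toolkit.RecordInstanceK 3 5 s₀ ((4 / 5 : ℝ) * s₀ - (19 / 45 : ℝ)) :=
  fun s₀ h1 h2 => recordInstanceK_of_lp 3 5 s₀ ((4 / 5 : ℝ) * s₀ - (19 / 45 : ℝ)) (by norm_num) (lp_RF s₀ h1 h2)

/-- **Parametric certified record `RF`** (registered sub-goal `recordAt_RF` of crux stmt-ABC-2757): for every `s₀ ∈ [7/4, 16/9]`, every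
`s < s₀` and `ε > 0`, `#{abc triples, c ≤ N, rad(abc) ≤ c^s} ≤ C · N^{4 s₀/5 − 19/45 + ε}` for `N ≥ 2`; the exponent `4 s₀/5 − 19/45` is `< 1`
iff `s₀ < 16/9`. -/
theorem recordAt_RF : ∀ s₀ : ℝ, 7 / 4 ≤ s₀ → s₀ ≤ 16 / 9 → Summit.ABC.ABC.Theorems.MazurKaneLaw.Toolkit.RecordAt s₀ ((4 / 5 : ℝ) * s₀ - (19 / 45 : ℝ)) :=
  fun s₀ h1 h2 => recordAt_of_shapeBound 5 s₀ ((4 / 5 : ℝ) * s₀ - (19 / 45 : ℝ)) (by norm_num) (by norm_num) (by linarith)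
    (by linarith) (shapeCount_le_of_recordInstanceK 3 5 s₀ ((4 / 5 : ℝ) * s₀ - (19 / 45 : ℝ)) (by norm_num) (by norm_num)
      (by linarith) (recordInstance_RF s₀ h1 h2))

/-- **`RF` in the crux's literal shape**: for `7/4 ≤ s < 16/9` and `ε > 0` there is `C` with
`#{abc triples (a,b,c) : c ≤ N, rad(abc) ≤ c^s} ≤ C · N^{4s/5 − 19/45 + ε}` for all `N ≥ 2` (exponent `< 1` for small `ε`). Take
`s₀ = min (16/9) (s + ε)` in `recordAt_RF` with `ε′ = ε/5`. -/
theorem mazurKane_count_le_rpow_RF (s : ℝ) (hs1 : 7 / 4 ≤ s) (hs2 : s < 16 / 9) (ε : ℝ) (hε : 0 < ε) :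
    ∃ C : ℝ, ∀ N : ℕ, 2 ≤ N →
      (Set.ncard {t : ℕ × ℕ × ℕ | Literature.NumberTheory.DiophantineGeometry.IsABCTriple t.1 t.2.1 t.2.2 ∧ t.2.2 ≤ N ∧
        ((Literature.NumberTheory.DiophantineGeometry.rad t.1 t.2.1 t.2.2 : ℕ) : ℝ) ≤ (t.2.2 : ℝ) ^ s} : ℝ) ≤
        C * (N : ℝ) ^ (4 * s / 5 - 19 / 45 + ε) := by
  have hm1 : min (16 / 9) (s + ε) ≤ 16 / 9 := min_le_left _ _
  have hm2 : min (16 / 9) (s + ε) ≤ s + ε := min_le_right _ _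
  have hm3 : s < min (16 / 9) (s + ε) := lt_min hs2 (by linarith)
  obtain ⟨C, hC⟩ := recordAt_RF (min (16 / 9) (s + ε)) (by linarith) hm1 s hm3 (ε / 5) (by positivity)
  exact ⟨max C 0, fun N hN => record_bound_mono hN (by linarith) (hC N hN)⟩

/-- **The sub-Kane window of the enlarged fibre toolkit, complete**: for every `s < 16/9` there are `θ < 1` and `C` with
`#{abc triples, c ≤ N, rad(abc) ≤ c^s} ≤ C · N^θ` for all `N ≥ 2` — a power saving below Kane's `N^{1+ε}` on all of `(1, 16/9)`
(`recordAt_74` of lead c1 below `7/4`, `recordAt_RF` on `[7/4, 16/9)`). The kit's exact LP value is `1` from `s = 16/9` on. -/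
theorem mazurKane_subKane (s : ℝ) (hs : s < 16 / 9) :
    ∃ θ : ℝ, θ < 1 ∧ ∃ C : ℝ, ∀ N : ℕ, 2 ≤ N →
      (Set.ncard {t : ℕ × ℕ × ℕ | Literature.NumberTheory.DiophantineGeometry.IsABCTriple t.1 t.2.1 t.2.2 ∧ t.2.2 ≤ N ∧
        ((Literature.NumberTheory.DiophantineGeometry.rad t.1 t.2.1 t.2.2 : ℕ) : ℝ) ≤ (t.2.2 : ℝ) ^ s} : ℝ) ≤ C * (N : ℝ) ^ θ := by
  rcases lt_or_ge s (7 / 4) with h | h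
  · obtain ⟨C, hC⟩ := recordAt_74 s h (1 / 100) (by norm_num)
    exact ⟨49 / 50 + 1 / 100, by norm_num, C, hC⟩
  · obtain ⟨C, hC⟩ := mazurKane_count_le_rpow_RF s h hs ((1 - (4 * s / 5 - 19 / 45)) / 2) (by linarith)
    exact ⟨4 * s / 5 - 19 / 45 + (1 - (4 * s / 5 - 19 / 45)) / 2, by linarith, C, hC⟩

/-! ### `RB`, `RC`: two more pieces of the certified curve on `[3/2, 33/20]` -/

/-- **Parametric record instance `RB`** (registered sub-goal `recordInstance_RB`): for every `s₀ ∈ [3/2, 8/5]`,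
`RecordInstance 5 s₀ ((19/40) s₀ + 7/40)`, from the generated parametric LP lemma `lp_RB`. -/
theorem recordInstance_RB : ∀ s₀ : ℝ, 3 / 2 ≤ s₀ → s₀ ≤ 8 / 5 → Summit.ABC.ABC.Theorems.MazurKaneLaw.Toolkit.RecordInstance 5 s₀ ((19 / 40 : ℝ) * s₀ + (7 / 40 : ℝ)) :=
  fun s₀ h1 h2 => recordInstance_of_lp 5 s₀ ((19 / 40 : ℝ) * s₀ + (7 / 40 : ℝ)) (by norm_num) (lp_RB s₀ h1 h2)

/-- **Parametric certified record `RB`** (registered sub-goal `recordAt_RB`): for every `s₀ ∈ [3/2, 8/5]`, every `s < s₀` and `ε > 0`,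
`#{abc triples, c ≤ N, rad(abc) ≤ c^s} ≤ C · N^{(19 s₀ + 7)/40 + ε}` for `N ≥ 2`. -/
theorem recordAt_RB : ∀ s₀ : ℝ, 3 / 2 ≤ s₀ → s₀ ≤ 8 / 5 → Summit.ABC.ABC.Theorems.MazurKaneLaw.Toolkit.RecordAt s₀ ((19 / 40 : ℝ) * s₀ + (7 / 40 : ℝ)) :=
  fun s₀ h1 h2 => recordAt_of_shapeBound 5 s₀ ((19 / 40 : ℝ) * s₀ + (7 / 40 : ℝ)) (by norm_num) (by norm_num) (by linarith)
    (by linarith) (shapeCount_le_of_recordInstance 5 s₀ ((19 / 40 : ℝ) * s₀ + (7 / 40 : ℝ)) (by norm_num) (by linarith)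
      (recordInstance_RB s₀ h1 h2))

/-- **Parametric record instance `RC`** (registered sub-goal `recordInstance_RC`): for every `s₀ ∈ [8/5, 33/20]`,
`RecordInstance 5 s₀ (s₀/2 + 27/200)`, from the generated parametric LP lemma `lp_RC`. -/
theorem recordInstance_RC : ∀ s₀ : ℝ, 8 / 5 ≤ s₀ → s₀ ≤ 33 / 20 → Summit.ABC.ABC.Theorems.MazurKaneLaw.Toolkit.RecordInstance 5 s₀ ((1 / 2 : ℝ) * s₀ + (27 / 200 : ℝ)) :=
  fun s₀ h1 h2 => recordInstance_of_lp 5 s₀ ((1 / 2 : ℝ) * s₀ + (27 / 200 : ℝ)) (by norm_num) (lp_RC s₀ h1 h2)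

/-- **Parametric certified record `RC`** (registered sub-goal `recordAt_RC`): for every `s₀ ∈ [8/5, 33/20]`, every `s < s₀` and `ε > 0`,
`#{abc triples, c ≤ N, rad(abc) ≤ c^s} ≤ C · N^{s₀/2 + 27/200 + ε}` for `N ≥ 2`. -/
theorem recordAt_RC : ∀ s₀ : ℝ, 8 / 5 ≤ s₀ → s₀ ≤ 33 / 20 → Summit.ABC.ABC.Theorems.MazurKaneLaw.Toolkit.RecordAt s₀ ((1 / 2 : ℝ) * s₀ + (27 / 200 : ℝ)) :=
  fun s₀ h1 h2 => recordAt_of_shapeBound 5 s₀ ((1 / 2 : ℝ) * s₀ + (27 / 200 : ℝ)) (by norm_num) (by norm_num) (by linarith)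
    (by linarith) (shapeCount_le_of_recordInstance 5 s₀ ((1 / 2 : ℝ) * s₀ + (27 / 200 : ℝ)) (by norm_num) (by linarith)
      (recordInstance_RC s₀ h1 h2))

/-! ### `RK`: the Mazur–Kane law on Kane's range `[2, 3)` -/

/-- **Parametric fine record instance `RK`** (registered sub-goal `recordInstance_RK`): for every `s₀ ∈ [2, 3]`,
`RecordInstanceK 3 3 s₀ (s₀ − 1)`, from the generated 5-node LP lemma `lp_RK` (Kane's lattices + sharp conic). -/
theorem recordInstance_RK : ∀ s₀ : ℝ, 2 ≤ s₀ → s₀ ≤ 3 → Summit.ABC.ABC.Theorems.MazurKaneLaw.Toolkit.RecordInstanceK 3 3 s₀ (s₀ - 1) :=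
  fun s₀ h1 h2 => recordInstanceK_of_lp 3 3 s₀ (s₀ - 1) (by norm_num) (lp_RK s₀ h1 h2)

/-- **Parametric certified record `RK`** (registered sub-goal `recordAt_RK` of crux stmt-ABC-2757): for every `s₀ ∈ [2, 3]`, every `s < s₀`
and `ε > 0`, `#{abc triples, c ≤ N, rad(abc) ≤ c^s} ≤ C · N^{s₀ − 1 + ε}` for `N ≥ 2` — the law's exponent on Kane's range. -/
theorem recordAt_RK : ∀ s₀ : ℝ, 2 ≤ s₀ → s₀ ≤ 3 → Summit.ABC.ABC.Theorems.MazurKaneLaw.Toolkit.RecordAt s₀ (s₀ - 1) :=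
  fun s₀ h1 h2 => recordAt_of_shapeBound 3 s₀ (s₀ - 1) (by norm_num) (by norm_num) (by linarith)
    (by linarith) (shapeCount_le_of_recordInstanceK 3 3 s₀ (s₀ - 1) (by norm_num) (by norm_num) (by linarith) (recordInstance_RK s₀ h1 h2))

/-- **The Mazur–Kane law on Kane's range** (registered sub-goal `mazurKaneLaw_on_Kane_range`; cf. D. Kane, JNT 154 (2015), Thm 2, and the
crux `MazurKaneLaw`, which asks the same for `1 < s < 2`): for every `2 ≤ s < 3` and `ε > 0` there is `C` with
`#{abc triples (a,b,c) : c ≤ N, rad(abc) ≤ c^s} ≤ C · N^{s − 1 + ε}` for all `N ≥ 2`. Take `s₀ = min 3 (s + ε/2)` in `recordAt_RK` with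
`ε′ = ε/2`. -/
theorem mazurKaneLaw_on_Kane_range : ∀ s : ℝ, 2 ≤ s → s < 3 → ∀ ε : ℝ, 0 < ε → ∃ C : ℝ, ∀ N : ℕ, 2 ≤ N → (Set.ncard {t : ℕ × ℕ × ℕ | Literature.NumberTheory.DiophantineGeometry.IsABCTriple t.1 t.2.1 t.2.2 ∧ t.2.2 ≤ N ∧ ((Literature.NumberTheory.DiophantineGeometry.rad t.1 t.2.1 t.2.2 : ℕ) : ℝ) ≤ (t.2.2 : ℝ) ^ s} : ℝ) ≤ C * (N : ℝ) ^ (s - 1 + ε) := by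
  intro s hs1 hs2 ε hε
  have hm1 : min 3 (s + ε / 2) ≤ 3 := min_le_left _ _
  have hm2 : min 3 (s + ε / 2) ≤ s + ε / 2 := min_le_right _ _
  have hm3 : s < min 3 (s + ε / 2) := lt_min hs2 (by linarith)
  obtain ⟨C, hC⟩ := recordAt_RK (min 3 (s + ε / 2)) (by linarith) hm1 s hm3 (ε / 2) (by positivity)
  exact ⟨max C 0, fun N hN => record_bound_mono hN (by linarith) (hC N hN)⟩

/-! ### `RW`: Kane's `N^{1+ε}` on the plateau `[16/9, 2]` -/

/-- **Parametric fine record instance `RW`** (registered sub-goal `recordInstance_RW`): for every `s₀ ∈ [16/9, 2]`,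
`RecordInstanceK 3 3 s₀ 1`, from the generated 5-node LP lemma `lp_RW`. -/
theorem recordInstance_RW : ∀ s₀ : ℝ, 16 / 9 ≤ s₀ → s₀ ≤ 2 → Summit.ABC.ABC.Theorems.MazurKaneLaw.Toolkit.RecordInstanceK 3 3 s₀ 1 :=
  fun s₀ h1 h2 => recordInstanceK_of_lp 3 3 s₀ 1 (by norm_num) (lp_RW s₀ h1 h2)

/-- **Parametric certified record `RW`** (registered sub-goal `recordAt_RW` of crux stmt-ABC-2757): for every `s₀ ∈ [16/9, 2]`, every
`s < s₀` and `ε > 0`, `#{abc triples, c ≤ N, rad(abc) ≤ c^s} ≤ C · N^{1 + ε}` for `N ≥ 2` (Kane's bound on the plateau of the kit). -/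
theorem recordAt_RW : ∀ s₀ : ℝ, 16 / 9 ≤ s₀ → s₀ ≤ 2 → Summit.ABC.ABC.Theorems.MazurKaneLaw.Toolkit.RecordAt s₀ 1 :=
  fun s₀ h1 h2 => recordAt_of_shapeBound 3 s₀ 1 (by norm_num) (by norm_num) (by linarith)
    (by norm_num) (shapeCount_le_of_recordInstanceK 3 3 s₀ 1 (by norm_num) (by norm_num) (by norm_num) (recordInstance_RW s₀ h1 h2))

end Summit.ABC.ABC.Theorems.MazurKaneLaw

end
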